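import Literature.Geometry.Kaehler.ComplexTorusSimpleAbelianThreefoldStablyNondegenerate
import Literature.Geometry.Kaehler.ComplexTorusLefschetzGroupDimensionCriterion
import HarnessLib

/-!
# The dimension of the Hodge group of a SIMPLE complex abelian THREEFOLD: `dim Hg(X) ∈ {3, 9, 21}` — `21 ⟺ End⁰(X) = ℚ`
# (`Sp₆`), `9` for a totally real cubic or an imaginary quadratic `End⁰(X)` (`Res_{F/ℚ} SL_{2,F}`, `U_F(V,ψ) ≅_ℂ GL₃`),
# `3 ⟺ End⁰(X)` a sextic CM field (`U_F`, CM type) — Moonen–Zarhin 1999 (2.3) with dimensions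

Layer `Literature/Geometry/Kaehler`, namespace `Literature.Geometry.Kaehler.ComplexTorus`; lane `lit-hodgefound`
(Track 2 foundations library), Layer A4, prover seat `lit-hodgefound-p17` (generation 50), self-proposed row g50-#8 —
the numerical companion of g50-#6 (Type IV(1,1): `𝔤|V_σ = 𝔤𝔩(V_σ)`, `𝔤 = 𝔩𝔣_ℂ`) and g50-#7 (every simple threefold is
stably nondegenerate): `dim_ℂ 𝔤 = 9` for Type IV(1,1) (the restriction `𝔤 → 𝔤𝔩(V_σ)` is an ISOMORPHISM — surjective by
g50-#6, injective by g50-#6 §1: an `E`-skew element of `𝔤 ⊆ 𝔩𝔣_ℂ` vanishing on `V_σ` vanishes on `V_σ̄`), `dim = 3` for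
Type IV(3,1) (Hazama's theorem in the tree, g49-#3 `ComplexTorusLefschetzGroupDimensionCriterion`, fed by g50-#7), and
the dictionary with g50-#4's totally-real half `(e, dim) ∈ {(1, 21), (3, 9)}`.  THEOREMS ONLY (no definition, no instance,
no notation, no named fact; D-0026, net debt 0).

## Sources, VERBATIM (held copies)

* B. J. J. Moonen, Yu. G. Zarhin, *Hodge classes on abelian varieties of low dimension*, Math. Ann. 315 (1999), held
  `paper:arxiv-math_9901113`, (2.3) `g = 3` (p0005 L83–L106): «Type I(1) […] `Hg(X) = Sp(V,φ) ≅ Sp_{6,ℚ}`. Type I(3)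
  […] `Hg(X) = Res_{F/ℚ} Sp_F(V,ψ)`. Type IV(1,1) […] `Hg(X) = U_F(V,ψ)`. Type IV(3,1): `End⁰(X) = F` is a CM-field
  of degree `6` over `ℚ`. Then `Hg(X) = U_F`»; Prop. (2.4)(2) (p0005 L116–L117): «Suppose `X` is of CM-type. Then
  `Hg(X)` is a `g`-dimensional algebraic torus»; proof of (2.4)(1) (L126–L131): «`Hg(X)_ℝ` is a unitary group of
  signature `(2,1)`».
* J. S. Milne, *Lefschetz classes on abelian varieties*, Duke Math. J. 96 (1999), held
  `paper:doi-10-1215-s0012-7094-99-09620-5`, §2 Remark 2.2 (p0009–p0010: «the map `α ↦ α|V₁ : U(φ)_Ω → GL(V₁)` is an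
  isomorphism») and Summary table p. 652 (types I and IV).
* B. B. Gordon, *A survey of the Hodge conjecture for abelian varieties* (1997∕1999), Thm. 6.4 (Hazama) and 2.13.
* J. E. Humphreys, *Introduction to Lie Algebras and Representation Theory* (1972), §1.2 (`dim 𝔤𝔩ₙ = n²`,
  `dim 𝔰𝔭₂ₗ = 2ℓ² + ℓ`).

## Contents

* §1 (Type IV(1,1): simple threefold, `[K:ℚ] = 2`, `K` CM, `f(K) = End⁰(X)`)
  **`IsSimple.finrank_hodgeGroupComplexLie_eq_nine_of_finrank_eq_two_of_finrank_eq_three`** (`dim_ℂ 𝔤 = 9 = dim 𝔤𝔩(V_σ)`),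
  `…finrank_hodgeGroupLie_eq_nine…` (`dim_ℝ 𝔥𝔤_ℝ = 9 = dim U(2,1)`), `…zdim_hodgeGroupC_eq_nine…` (`dim Hg(X) = 9`),
  `…finrank_lefschetzLie_eq_nine…` (`dim Lf(X) = 9`).
* §2 (every simple threefold, through the centre `F` of `End⁰(X)`, `e = [F:ℚ]`)
  `IsSimple.finrank_hodgeGroupLie_eq_nine_of_finrank_centerField_eq_two_of_finrank_eq_three`,
  `IsSimple.finrank_hodgeGroupLie_eq_three_of_finrank_centerField_eq_six_of_finrank_eq_three` (Type IV(3,1), Hazama),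
  **`IsSimple.finrank_hodgeGroupLie_eq_of_isCMField_of_finrank_eq_three`** (`(e, dim Hg) ∈ {(2, 9), (6, 3)}`),
  **`IsSimple.finrank_hodgeGroupLie_eq_three_or_eq_nine_or_eq_of_finrank_eq_three`** (`dim Hg ∈ {3, 9, 21}`),
  `IsRiemannForm.finrank_hodgeGroupLie_eq_iff_endAlgRat_eq_bot_of_finrank_eq_three` (`21 ⟺ End⁰ = ℚ`, every threefold),
  **`IsSimple.isTorusSubgroup_mumfordTateGroupC_of_finrank_hodgeGroupLie_eq_three`** (`dim Hg = 3 ⟹` CM type).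
-/

noncomputable section

open scoped Matrix
open Module Matrix NormedSpace NumberField
open Literature.NumberTheory.Automorphic (IsZConnected IsTorusSubgroup)

namespace Literature.Geometry.Kaehler

namespace ComplexTorus

/-! ## §1 Type IV(1,1): `dim_ℂ 𝔤 = dim_ℝ 𝔥𝔤_ℝ = dim Hg(X) = dim Lf(X) = 9` -/

section QuadraticCM

variable {ι : Type} [Fintype ι] [DecidableEq ι] {E : Type} [NormedAddCommGroup E] [NormedSpace ℂ E]
  [FiniteDimensional ℂ E] {Φ : (ι → ℝ) ≃L[ℝ] E} {η : E [⋀^Fin 2]→L[ℝ] ℝ} {K : Type} [Field K] [NumberField K]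
  [IsCMField K]

omit [IsCMField K] in
/-- The two complex embeddings of a quadratic field with a non-real embedding `σ` are `σ` and `σ̄`. [folklore] -/
private theorem eq_or_eq_conjugate_of_finrank_eq_two₅₀₈ (hK : finrank ℚ K = 2) {σ : K →+* ℂ}
    (hσ : ComplexEmbedding.conjugate σ ≠ σ) (τ : K →+* ℂ) : τ = σ ∨ τ = ComplexEmbedding.conjugate σ := by
  classical
  by_contra h
  push Not at h
  have hcard : Fintype.card (K →+* ℂ) = 2 := by rw [NumberField.Embeddings.card, hK]
  have h3 : ({σ, ComplexEmbedding.conjugate σ, τ} : Finset (K →+* ℂ)).card = 3 := by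
    rw [Finset.card_insert_of_notMem (by simp [hσ.symm, Ne.symm h.1]),
      Finset.card_insert_of_notMem (by simp [Ne.symm h.2]), Finset.card_singleton]
  have hle := Finset.card_le_univ ({σ, ComplexEmbedding.conjugate σ, τ} : Finset (K →+* ℂ))
  omega

omit [FiniteDimensional ℂ E] [NumberField K] [IsCMField K] in
/-- `V_ℂ = V_σ + V_σ̄` for a quadratic field and a non-real `σ`. [folklore] [cite: MoonenZarhin1998WeilClasses, §3 (3)] -/
private theorem sup_iInf_eigenspace_conjugate_eq_top₅₀₈ [NumberField K] (f : K →ₐ[ℚ] Matrix ι ι ℚ)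
    (hK : finrank ℚ K = 2) {σ : K →+* ℂ} (hσ : ComplexEmbedding.conjugate σ ≠ σ) :
    (⨅ a : K, Module.End.eigenspace (Matrix.toLin' ((f a).map (algebraMap ℚ ℂ))) (σ a)) ⊔
      (⨅ a : K, Module.End.eigenspace (Matrix.toLin' ((f a).map (algebraMap ℚ ℂ)))
        (ComplexEmbedding.conjugate σ a)) = ⊤ := by
  rw [eq_top_iff, ← iSup_iInf_eigenspace_toLin'_map_eq_top f]
  refine iSup_le fun τ ↦ ?_
  rcases eq_or_eq_conjugate_of_finrank_eq_two₅₀₈ hK hσ τ with rfl | rfl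
  · exact le_sup_left
  · exact le_sup_right

/-- **MZ99 (2.3) TYPE IV(1,1) WITH DIMENSIONS: `dim_ℂ 𝔤 = 9`** for a SIMPLE polarised complex torus of dimension `3`
whose endomorphism algebra `End⁰(X) = f(K)` is an imaginary quadratic (CM, degree `2`) field: the restriction
`𝔤 → 𝔤𝔩(V_σ)` to an eigenspace `V_σ` (`dim V_σ = 3`) is an ISOMORPHISM — onto by g50-#6
(`IsSimple.exists_mem_hodgeGroupLieC_forall_mulVec_eq_of_finrank_eq_two_of_finrank_eq_three`), injective because an
element of `𝔤 ⊆ 𝔩𝔣_ℂ` vanishing on `V_σ` vanishes on `V_σ̄` (g50-#6 §1) and `V_ℂ = V_σ ⊕ V_σ̄` («the map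
`α ↦ α|V₁ : U(φ)_Ω → GL(V₁)` is an isomorphism»; `dim U_F(V,ψ) = dim GL₃ = 9`).
[cite: MoonenZarhin1999LowDim, §2 (2.3) `g = 3`, Type IV(1,1) («`Hg(X) = U_F(V,ψ)`») and proof of (2.4)(1)]
[cite: Milne1999LefschetzClasses, §2 Remark 2.2 and Summary table (type IV, «Dimension»)] [cite: Humphreys1972, §1.2] -/
theorem IsSimple.finrank_hodgeGroupComplexLie_eq_nine_of_finrank_eq_two_of_finrank_eq_three (hX : IsSimple Φ)
    (hη : IsRiemannForm Φ η) (hK : finrank ℚ K = 2) (hE : finrank ℂ E = 3) (f : K →ₐ[ℚ] Matrix ι ι ℚ)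
    (hfE : f.range = endAlgRat Φ) : finrank ℂ (hodgeGroupComplexLie Φ) = 9 := by
  classical
  letI : LieRing (Matrix ι ι ℂ) := LieRing.ofAssociativeRing
  letI : LieAlgebra ℂ (Matrix ι ι ℂ) := LieAlgebra.ofAssociativeAlgebra
  have hfE' : ∀ y, f y ∈ endAlgRat Φ := fun y ↦ by rw [← hfE]; exact AlgHom.mem_range_self f y
  have hcard : Fintype.card ι = 6 := by rw [card_eq_two_mul_finrank Φ, hE]
  haveI : Nonempty ι := Fintype.card_pos_iff.1 (by omega)
  -- an embedding `σ`, `σ̄ ≠ σ`, the eigenspace `W = V_σ` of dimension `3`, `V_ℂ = V_σ + V_σ̄`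
  obtain ⟨σ⟩ : Nonempty (K →+* ℂ) := by
    have h : 0 < Fintype.card (K →+* ℂ) := by rw [NumberField.Embeddings.card, hK]; norm_num
    exact Fintype.card_pos_iff.1 h
  have hσ : ComplexEmbedding.conjugate σ ≠ σ := fun h ↦
    IsTotallyComplex.complexEmbedding_not_isReal σ (ComplexEmbedding.isReal_iff.2 h)
  have hsup := sup_iInf_eigenspace_conjugate_eq_top₅₀₈ f hK hσ
  set W : Submodule ℂ (ι → ℂ) :=
    ⨅ a : K, Module.End.eigenspace (Matrix.toLin' ((f a).map (algebraMap ℚ ℂ))) (σ a) with hWdef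
  have hW3 : finrank ℂ W = 3 := by
    have h : finrank ℂ W * finrank ℚ K = Fintype.card ι := finrank_iInf_eigenspace_toLin'_map_mul_finrank f σ
    rw [hK, hcard] at h
    omega
  -- the Rosati involution is complex conjugation on `f(K)`: `f(K)` is `E`-skew-hermitian
  obtain ⟨G, hGη⟩ := hη.exists_ratMatrix_latticeGram
  have hGu : IsUnit G.det := isUnit_det_of_map_ratCast hGη hη.isUnit_det_latticeGram
  have hsym : ∀ a : K, (f a)ᵀ * G = G * f (IsCMField.complexConj K a) := fun a ↦
    (rosati_eq_iff hGu (f a) _).1 (rosati_eq_complexConj_of_range_eq_endAlgRat Φ hη.1 hη.2.2 hGη f hfE a)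
  -- `𝔊 = 𝔤`, transported to `End(ℂ^ι)` along `Matrix.toLin'`
  set 𝔊 : Submodule ℂ (Module.End ℂ (ι → ℂ)) :=
    (hodgeGroupComplexLie Φ).toSubmodule.comap
      (LinearMap.toMatrix' : Module.End ℂ (ι → ℂ) ≃ₗ[ℂ] Matrix ι ι ℂ).toLinearMap with h𝔊def
  have hmem𝔊 : ∀ Y : Module.End ℂ (ι → ℂ), Y ∈ 𝔊 ↔ LinearMap.toMatrix' Y ∈ hodgeGroupLieC Φ := fun Y ↦ by
    rw [h𝔊def, Submodule.mem_comap, LinearEquiv.coe_coe, LieSubalgebra.mem_toSubmodule,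
      mem_hodgeGroupComplexLie_iff_mem_hodgeGroupLieC]
  have hfin𝔊 : finrank ℂ 𝔊 = finrank ℂ (hodgeGroupComplexLie Φ) :=
    (LinearEquiv.ofSubmodule' (LinearMap.toMatrix' : Module.End ℂ (ι → ℂ) ≃ₗ[ℂ] Matrix ι ι ℂ)
      (hodgeGroupComplexLie Φ).toSubmodule).finrank_eq
  have hYv : ∀ (Y : Module.End ℂ (ι → ℂ)) (v : ι → ℂ), Y v = LinearMap.toMatrix' Y *ᵥ v := fun Y v ↦ by
    conv_lhs => rw [← Matrix.toLin'_toMatrix' Y]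
    rw [Matrix.toLin'_apply]
  have hst : ∀ Y ∈ 𝔊, ∀ w ∈ W, Y w ∈ W := fun Y hY w hw ↦ by
    rw [hYv Y w]
    exact mulVec_mem_iInf_eigenspace_algHom_of_mem_hodgeGroupLieC f hfE' σ ((hmem𝔊 Y).1 hY) hw
  -- an element of `𝔤 ⊆ 𝔩𝔣_ℂ` vanishing on `V_σ` vanishes on `V_σ̄`, hence on `V_ℂ`
  have hzero : ∀ Y ∈ 𝔊, (∀ w ∈ W, Y w = 0) → Y = 0 := by
    intro Y hY hYW
    have hZ : LinearMap.toMatrix' Y ∈ hodgeGroupLieC Φ := (hmem𝔊 _).1 hY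
    have hZL : LinearMap.toMatrix' Y ∈ lefschetzLieC Φ G := hη.hodgeGroupLieC_subset_lefschetzLieC hGη hZ
    have hD0 : ∀ v ∈ W, LinearMap.toMatrix' Y *ᵥ v = 0 := fun v hv ↦ by rw [← hYv]; exact hYW v hv
    have hDW : ∀ u ∈ ⨅ a : K, Module.End.eigenspace (Matrix.toLin' ((f a).map (algebraMap ℚ ℂ)))
        (ComplexEmbedding.conjugate σ a),
      LinearMap.toMatrix' Y *ᵥ u ∈ ⨅ a : K, Module.End.eigenspace
        (Matrix.toLin' ((f a).map (algebraMap ℚ ℂ))) (ComplexEmbedding.conjugate σ a) := fun u hu ↦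
      mulVec_mem_iInf_eigenspace_algHom_of_mem_hodgeGroupLieC f hfE' (ComplexEmbedding.conjugate σ) hZ hu
    have hD0' : ∀ w ∈ ⨅ a : K, Module.End.eigenspace (Matrix.toLin' ((f a).map (algebraMap ℚ ℂ)))
        (ComplexEmbedding.conjugate σ a), LinearMap.toMatrix' Y *ᵥ w = 0 := fun w hw ↦
      mulVec_eq_zero_of_forall_mulVec_eq_zero_of_mem_iInf_eigenspace_conjugate f hGu.ne_zero hsym hσ hsup
        ((mem_lefschetzLieC_iff Φ).1 hZL).1 hDW hD0 hw
    refine LinearMap.ext fun v ↦ ?_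
    have hv : v ∈ W ⊔ (⨅ a : K, Module.End.eigenspace (Matrix.toLin' ((f a).map (algebraMap ℚ ℂ)))
        (ComplexEmbedding.conjugate σ a)) := by
      rw [hsup]; exact Submodule.mem_top
    obtain ⟨y, hy, z, hz, rfl⟩ := Submodule.mem_sup.1 hv
    rw [LinearMap.zero_apply, hYv, Matrix.mulVec_add, hD0 y hy, hD0' z hz, add_zero]
  -- the restriction map `r : 𝔊 → 𝔤𝔩(V_σ)` is a linear bijection
  obtain ⟨r, hr⟩ : ∃ r : 𝔊 →ₗ[ℂ] Module.End ℂ W,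
      ∀ (Y : 𝔊) (w : W), ((r Y w : W) : ι → ℂ) = (Y : Module.End ℂ (ι → ℂ)) w :=
    ⟨{ toFun := fun Y ↦ (Y : Module.End ℂ (ι → ℂ)).restrict (hst Y Y.2)
       map_add' := fun Y Y' ↦ LinearMap.ext fun w ↦ Subtype.ext (by
         simp only [LinearMap.coe_restrict_apply, Submodule.coe_add, LinearMap.add_apply])
       map_smul' := fun c Y ↦ LinearMap.ext fun w ↦ Subtype.ext (by
         simp only [LinearMap.coe_restrict_apply, Submodule.coe_smul, LinearMap.smul_apply, RingHom.id_apply]) },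
      fun _ _ ↦ rfl⟩
  have hinj : Function.Injective r := fun Y Y' hYY' ↦ by
    have h0 : ((Y : Module.End ℂ (ι → ℂ)) - (Y' : Module.End ℂ (ι → ℂ))) = 0 :=
      hzero _ (𝔊.sub_mem Y.2 Y'.2) fun w hw ↦ by
        have h := congrArg (fun T : Module.End ℂ W ↦ ((T ⟨w, hw⟩ : W) : ι → ℂ)) hYY'
        simp only [hr] at h
        rw [LinearMap.sub_apply, h, sub_self]
    exact Subtype.ext (sub_eq_zero.1 h0)
  have hsurj : Function.Surjective r := fun Yw ↦ by
    obtain ⟨Z, hZ, hZY⟩ :=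
      hX.exists_mem_hodgeGroupLieC_forall_mulVec_eq_of_finrank_eq_two_of_finrank_eq_three hη hK hE f hfE σ hWdef Yw
    have hZ𝔊 : Matrix.toLin' Z ∈ 𝔊 := (hmem𝔊 _).2 (by rw [LinearMap.toMatrix'_toLin']; exact hZ)
    refine ⟨⟨Matrix.toLin' Z, hZ𝔊⟩, LinearMap.ext fun w ↦ Subtype.ext ?_⟩
    rw [hZY w, hr]
    exact Matrix.toLin'_apply Z _
  -- count dimensions
  rw [← hfin𝔊, (LinearEquiv.ofBijective r ⟨hinj, hsurj⟩).finrank_eq,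
    show finrank ℂ (Module.End ℂ W) = finrank ℂ W * finrank ℂ W from Module.finrank_linearMap ℂ ℂ W W, hW3]

/-- **`dim_ℝ 𝔥𝔤_ℝ = 9`** for Type IV(1,1) («`Hg(X)_ℝ` is a unitary group of signature `(2,1)`», `dim U(2,1) = 9`).
[cite: MoonenZarhin1999LowDim, §2 (2.3) `g = 3`, Type IV(1,1) and proof of (2.4)(1)] [cite: Milne1999LefschetzClasses, §2 Summary table (type IV)] -/
theorem IsSimple.finrank_hodgeGroupLie_eq_nine_of_finrank_eq_two_of_finrank_eq_three (hX : IsSimple Φ)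
    (hη : IsRiemannForm Φ η) (hK : finrank ℚ K = 2) (hE : finrank ℂ E = 3) (f : K →ₐ[ℚ] Matrix ι ι ℚ)
    (hfE : f.range = endAlgRat Φ) : finrank ℝ (hodgeGroupLie Φ) = 9 := by
  rw [← finrank_hodgeGroupComplexLie_eq_finrank_hodgeGroupLie Φ]
  exact hX.finrank_hodgeGroupComplexLie_eq_nine_of_finrank_eq_two_of_finrank_eq_three hη hK hE f hfE

/-- **`dim Hg(X) = 9`** for Type IV(1,1) (the dimension of the connected algebraic group `Hg(X)(ℂ) ≤ GL(V_ℂ)`,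
`= dim GL₃` by Milne's Remark 2.2). [cite: MoonenZarhin1999LowDim, §2 (2.3) `g = 3`, Type IV(1,1)]
[cite: Milne1999LefschetzClasses, §2 Summary table (type IV, «Dimension»)] [cite: GoodmanWallachGTM255, §1.4.4 Thm. 1.4.10] -/
theorem IsSimple.zdim_hodgeGroupC_eq_nine_of_finrank_eq_two_of_finrank_eq_three (hX : IsSimple Φ)
    (hη : IsRiemannForm Φ η) (hK : finrank ℚ K = 2) (hE : finrank ℂ E = 3) (f : K →ₐ[ℚ] Matrix ι ι ℚ)
    (hfE : f.range = endAlgRat Φ) : (isZConnected_map_toGL_hodgeGroupC Φ).zdim = 9 :=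
  (zdim_hodgeGroupC_eq_iff_finrank_hodgeGroupLie_eq Φ).2
    (hX.finrank_hodgeGroupLie_eq_nine_of_finrank_eq_two_of_finrank_eq_three hη hK hE f hfE)

/-- **`dim_ℝ 𝔩𝔣 = dim Lf(X) = 9`** for Type IV(1,1) (`Lf(X) = U_F(V,ψ) = Hg(X)`, g50-#6).
[cite: MoonenZarhin1999LowDim, §2 (2.3) `g = 3`, Type IV(1,1)] [cite: Milne1999LefschetzClasses, §2 Summary table (type IV)] -/
theorem IsSimple.finrank_lefschetzLie_eq_nine_of_finrank_eq_two_of_finrank_eq_three (hX : IsSimple Φ)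
    (hη : IsRiemannForm Φ η) (hK : finrank ℚ K = 2) (hE : finrank ℂ E = 3) (f : K →ₐ[ℚ] Matrix ι ι ℚ)
    (hfE : f.range = endAlgRat Φ) {G : Matrix ι ι ℚ} (hGη : G.map (Rat.cast : ℚ → ℝ) = latticeGram Φ η) :
    finrank ℝ (lefschetzLie Φ G) = 9 := by
  rw [← (hη.hodgeGroupC_eq_lefschetzIdentityC_iff_finrank_eq hGη).1
    (hX.hodgeGroupC_eq_lefschetzIdentityC_of_finrank_eq_two_of_finrank_eq_three hη hK hE f hfE hGη)]
  exact hX.finrank_hodgeGroupLie_eq_nine_of_finrank_eq_two_of_finrank_eq_three hη hK hE f hfE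

end QuadraticCM

/-! ## §2 The dictionary for simple threefolds: `dim Hg(X) ∈ {3, 9, 21}` -/

section Dictionary

variable {κ : Type} [Fintype κ] [DecidableEq κ] [Nonempty κ] {E : Type} [NormedAddCommGroup E] [NormedSpace ℂ E]
  [FiniteDimensional ℂ E] {Ψ : (κ → ℝ) ≃L[ℝ] E} {η : E [⋀^Fin 2]→L[ℝ] ℝ}

omit [FiniteDimensional ℂ E] in
/-- `End⁰(X)` is commutative when `[End⁰(X) : F] = 1`. [folklore] -/
private theorem endAlgRat_comm_of_finrank_eq_one₅₀₈ (hX : IsSimple Ψ) (h1 : finrank (centerField Ψ hX) (endAlgRat Ψ) = 1) :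
    ∀ a ∈ endAlgRat Ψ, ∀ b ∈ endAlgRat Ψ, a * b = b * a := fun a ha b hb ↦ by
  rw [← hX.range_valAlgHom_eq_endAlgRat_of_finrank_eq_one h1] at ha hb
  obtain ⟨x, rfl⟩ := (AlgHom.mem_range _).1 ha
  obtain ⟨y, rfl⟩ := (AlgHom.mem_range _).1 hb
  rw [← map_mul, ← map_mul, mul_comm]

/-- **Type IV(1,1) through the centre: `dim_ℝ 𝔥𝔤_ℝ = 9`** for a simple polarised threefold whose centre (`= End⁰(X)`)
is a CM field of degree `2`. [cite: MoonenZarhin1999LowDim, §2 (2.3) `g = 3`, Type IV(1,1)] -/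
theorem IsSimple.finrank_hodgeGroupLie_eq_nine_of_finrank_centerField_eq_two_of_finrank_eq_three (hX : IsSimple Ψ)
    [IsCMField (centerField Ψ hX)] (hη : IsRiemannForm Ψ η) (he : finrank ℚ (centerField Ψ hX) = 2)
    (h3 : finrank ℂ E = 3) : finrank ℝ (hodgeGroupLie Ψ) = 9 :=
  hX.finrank_hodgeGroupLie_eq_nine_of_finrank_eq_two_of_finrank_eq_three hη he h3 (centerField.valAlgHom Ψ hX)
    (hX.range_valAlgHom_eq_endAlgRat_of_finrank_eq_one (hX.finrank_centerField_endAlgRat_eq_one_of_finrank_eq_three h3))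

/-- **Type IV(3,1): `dim_ℝ 𝔥𝔤_ℝ = 3 = g`** for a simple polarised threefold whose centre (`= End⁰(X)`) is a CM field of
degree `6` — Hazama's theorem (the tree's `…iff_finrank_hodgeGroupLie_eq_finrank_of_isCMField_of_endAlgRat_comm`,
g49-#3) applied to the stable nondegeneracy of g50-#7 («Suppose `X` is of CM-type. Then `Hg(X)` is a `g`-dimensional
algebraic torus»). [cite: MoonenZarhin1999LowDim, §2 (2.3) Type IV(3,1) and Prop. (2.4)(2) (p0005 L116–L117)]
[cite: Gordon1997, Thm. 6.4 (Hazama) and 2.13] -/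
theorem IsSimple.finrank_hodgeGroupLie_eq_three_of_finrank_centerField_eq_six_of_finrank_eq_three (hX : IsSimple Ψ)
    [IsCMField (centerField Ψ hX)] (hη : IsRiemannForm Ψ η) (he : finrank ℚ (centerField Ψ hX) = 6)
    (h3 : finrank ℂ E = 3) : finrank ℝ (hodgeGroupLie Ψ) = 3 := by
  have h1 := hX.finrank_centerField_endAlgRat_eq_one_of_finrank_eq_three h3
  have hfE := hX.range_valAlgHom_eq_endAlgRat_of_finrank_eq_one h1
  have hcard : Fintype.card κ = 6 := by rw [card_eq_two_mul_finrank Ψ, h3]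
  have hdim : finrank ℚ (endAlgRat Ψ) = Fintype.card κ := by
    rw [hcard, ← he, ← (Subalgebra.equivOfEq _ _ hfE).toLinearEquiv.finrank_eq,
      ← (AlgEquiv.ofInjectiveField (centerField.valAlgHom Ψ hX)).toLinearEquiv.finrank_eq]
  rw [(hX.forall_divisorClasses_powPeriod_eq_hodgeClasses_iff_finrank_hodgeGroupLie_eq_finrank_of_isCMField_of_endAlgRat_comm
    hη (endAlgRat_comm_of_finrank_eq_one₅₀₈ hX h1) hdim).1
    (hX.forall_divisorClasses_powPeriod_eq_hodgeClasses_of_finrank_eq_three hη h3), h3]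

/-- **SIMPLE THREEFOLDS WITH CM CENTRE: `(e, dim Hg) ∈ {(2, 9), (6, 3)}`** (Types IV(1,1), IV(3,1)).
[cite: MoonenZarhin1999LowDim, §2 (2.3) `g = 3`, Types IV(1,1) («`U_F(V,ψ)`»), IV(3,1) («`U_F`»)] [cite: Milne1999LefschetzClasses, §2 Summary table (type IV)] -/
theorem IsSimple.finrank_hodgeGroupLie_eq_of_isCMField_of_finrank_eq_three (hX : IsSimple Ψ)
    [IsCMField (centerField Ψ hX)] (hη : IsRiemannForm Ψ η) (h3 : finrank ℂ E = 3) :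
    (finrank ℚ (centerField Ψ hX) = 2 ∧ finrank ℝ (hodgeGroupLie Ψ) = 9) ∨
      (finrank ℚ (centerField Ψ hX) = 6 ∧ finrank ℝ (hodgeGroupLie Ψ) = 3) := by
  rcases hX.finrank_centerField_eq_two_or_eq_six_of_finrank_eq_three h3 with he | he
  · exact Or.inl ⟨he, hX.finrank_hodgeGroupLie_eq_nine_of_finrank_centerField_eq_two_of_finrank_eq_three hη he h3⟩
  · exact Or.inr ⟨he, hX.finrank_hodgeGroupLie_eq_three_of_finrank_centerField_eq_six_of_finrank_eq_three hη he h3⟩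

/-- **THE DIMENSION OF THE HODGE GROUP OF A SIMPLE COMPLEX ABELIAN THREEFOLD IS `3`, `9` OR `21`** (MZ99 (2.3) with
dimensions: I(1) `Sp₆`: `21`; I(3) `Res_{F/ℚ} SL_{2,F}`: `9`; IV(1,1) `U_F(V,ψ)`: `9`; IV(3,1) `U_F`: `3`).
[cite: MoonenZarhin1999LowDim, §2 (2.3) `g = 3` («There are four cases»)] [cite: Milne1999LefschetzClasses, §2 Summary table] [cite: Humphreys1972, §1.2] -/
theorem IsSimple.finrank_hodgeGroupLie_eq_three_or_eq_nine_or_eq_of_finrank_eq_three (hX : IsSimple Ψ)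
    (hη : IsRiemannForm Ψ η) (h3 : finrank ℂ E = 3) :
    finrank ℝ (hodgeGroupLie Ψ) = 3 ∨ finrank ℝ (hodgeGroupLie Ψ) = 9 ∨ finrank ℝ (hodgeGroupLie Ψ) = 21 := by
  rcases hX.centerField_isTotallyReal_or_isCMField hη with hR | hCM
  · haveI := hR
    rcases hX.finrank_hodgeGroupLie_eq_of_isTotallyReal_of_finrank_eq_three hη h3 with ⟨-, h⟩ | ⟨-, h⟩
    · exact Or.inr (Or.inr h)
    · exact Or.inr (Or.inl h)
  · haveI := hCM
    rcases hX.finrank_hodgeGroupLie_eq_of_isCMField_of_finrank_eq_three hη h3 with ⟨-, h⟩ | ⟨-, h⟩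
    · exact Or.inr (Or.inl h)
    · exact Or.inl h

omit [Nonempty κ] in
/-- **`dim Hg(X) = 21 ⟺ End⁰(X) = ℚ` for EVERY polarised abelian threefold** (`21 = dim Sp₆`; `Hg(X) = Sp(V,E) ⟺
End⁰(X) = ℚ` at `g = 3`, the tree's `IsRiemannForm.hodgeGroup_eq_spGroup_iff_endAlgRat_eq_bot_of_finrank_eq_three`).
[cite: MoonenZarhin1999LowDim, §2 (2.3) `g = 3`, Type I(1) («`Hg(X) = Sp(V,φ) ≅ Sp_{6,ℚ}`»)] [cite: Humphreys1972, §1.2 (`dim 𝔰𝔭₆ = 21`)] -/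
theorem IsRiemannForm.finrank_hodgeGroupLie_eq_iff_endAlgRat_eq_bot_of_finrank_eq_three (hη : IsRiemannForm Ψ η)
    (h3 : finrank ℂ E = 3) : finrank ℝ (hodgeGroupLie Ψ) = 21 ↔ endAlgRat Ψ = ⊥ := by
  rw [← hη.hodgeGroup_eq_spGroup_iff_endAlgRat_eq_bot_of_finrank_eq_three h3,
    hη.hodgeGroup_eq_spGroup_iff_finrank_hodgeGroupLie_eq, h3]

/-- **A SIMPLE THREEFOLD WITH `dim Hg(X) = 3` IS OF CM TYPE** (`MT(X)(ℂ)` is a torus): by the dictionary its centre is a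
CM field of degree `6 = 2g` (Type IV(3,1)). [cite: MoonenZarhin1999LowDim, §2 (2.3) Type IV(3,1) and Prop. (2.4)(2)]
[cite: Gordon1997, §2 Prop. 2.12] -/
theorem IsSimple.isTorusSubgroup_mumfordTateGroupC_of_finrank_hodgeGroupLie_eq_three (hX : IsSimple Ψ)
    (hη : IsRiemannForm Ψ η) (h3 : finrank ℂ E = 3) (hdim : finrank ℝ (hodgeGroupLie Ψ) = 3) :
    IsTorusSubgroup (mumfordTateGroupC Ψ) := by
  rcases hX.centerField_isTotallyReal_or_isCMField hη with hR | hCM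
  · haveI := hR
    rcases hX.finrank_hodgeGroupLie_eq_of_isTotallyReal_of_finrank_eq_three hη h3 with ⟨-, h⟩ | ⟨-, h⟩ <;> omega
  · haveI := hCM
    rcases hX.finrank_hodgeGroupLie_eq_of_isCMField_of_finrank_eq_three hη h3 with ⟨-, h⟩ | ⟨he, -⟩
    · omega
    · exact hX.isTorusSubgroup_mumfordTateGroupC_of_finrank_centerField_eq_six h3 he

end Dictionary

end ComplexTorus

end Literature.Geometry.Kaehler
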